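import Summits.QuantumFields.YangMills.Theorems.BalabanUVNodesN14VarianceSocket

/-!
# BalabanUVNodes ∕ node N14 = NE1′ — THE VARIANCE ROUTE ON THE DECOUPLED MODEL: the tilted law of a product is a product, the tilted
# VARIANCE splits, and the influence of one decoupled slot on it is second order WITH NO CENTRING (LENS control, card 3 on gen 4's model)

Cell `pub-ymgap`, HUMAN RULING D-0062 (Track A at full width), seat `pub-ymgap-dag-n14-c` (R134 ACCELERATION, strategy s1), generation 3;
route `Summits/QuantumFields/YangMills/Theses/BalabanUVNodes.lean` (cluster K3′ `SpineGivenEndpointR12`, `--supports … --as helper`); venue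
ruling R424 (`YangMills/Theorems`, namespace `YMDAG.N14.VarianceInfluence`).  ADDITIVE — imports this seat's `…N14VarianceSocket.lean`
(p468368 ✓: `abs_tiltedMean_sub_sub_le`; hence the gaps-ne1 module `Spine/NE1p/TiltedMeanInfluence`: `tiltedMean_prod_add`, `influence_eq`,
`variance_tilted_le_sq`) ONLY; theorems only; modifies nothing.

WHAT THIS IS.  Gen 4 of the gaps census (`TiltedMeanInfluence` §3, NE1.md R32–R34) made the second order of an OLD slot's influence on the
tilted first moment a kernel theorem in the exactly-decoupled setting — product law `ρ ⊗ κ`, observable `G ⊕ h`, slot amplitude `|h| ≤ a` —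
AT THE PRICE OF CENTRING: `|influence| ≤ 2a` always (`abs_influence_le`), `≤ 2a²·|s|` when BOTH slot laws centre `h`
(`abs_influence_le_of_centred`; in the application centring = conjugation symmetry × flatness, census R28 (2)).  The control lens (card 3)
routes through the tilted VARIANCE instead, and on the same model this file shows what centring was buying — only the zero-tilt term:
* §1 `tilted_prod_add` [folklore]: the tilt of a product law by a SUM is the product of the tilted marginals,
  `(ρ ⊗ κ).tilted (f ⊕ g) = ρ.tilted f ⊗ κ.tilted g` (Mathlib `prod_withDensity`, `integral_prod_mul`; no integrability hypothesis —
  both sides vanish together).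
* §2 `variance_tilted_prod_add`: hence the tilted VARIANCE of `G ⊕ h` splits, `Var_s(G ⊕ h) = Var_{ρ,s}(G) + Var_{κ,s}(h)` (Mathlib
  `variance_add_prod` under the tilted product law).
* §3 `variance_influence_eq` ∕ **`abs_variance_influence_le`**: re-sampling the slot (`κ_A ↦ κ_B`) moves the tilted variance by exactly
  `Var_{κ_B,s}(h) − Var_{κ_A,s}(h)`, of size `≤ a²` for EVERY tilt `s` and ANY two slot laws — NO centring, NO symmetry, NO flatness
  (both variances lie in `[0, a²]`, `TiltedMeanInfluence.variance_tilted_le_sq`).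
* §4 **`abs_influence_sub_influence_zero_le`**: through the socket's mean value step (`…N14VarianceSocket.abs_tiltedMean_sub_sub_le`) the
  influence on the tilted MEAN satisfies `|Δ(s) − Δ(0)| ≤ a²·|s|` unconditionally; with centring (`Δ(0) = 0`) this RECOVERS gen 4's
  `abs_influence_le_of_centred` with the constant improved `2a² ↦ a²` (`abs_influence_le_of_centred'`).  So in the decoupled model the
  variance route books every old slot at second order with no hypothesis on the slot laws, and isolates the ONE first-order datum the socket
  must be fed separately: the zero-tilt discrepancy `Δ(0)` (= the undressed first-moment matching `η₀`, NE1.md R23 (a)).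

WHAT THIS IS NOT.  [folklore] measure theory on PRODUCT data; Bałaban's class-conditioned laws are not product laws (the decoupling there is
NODE O's object — under the lens: the engine `CovGradBound` of `…N14CovGradEngine` for the history-conditioned fibre laws); nothing of
[Balaban1989LargeFieldII] is asserted; N14 NOT discharged; count-neutral.  One finite four-torus programme at fixed ε; NOT ℝ⁴, NOT OS, NOT a
mass gap, NOT Clay.  0 sorry.
-/

noncomputable section

namespace YMDAG.N14.VarianceInfluence

open MeasureTheory ProbabilityTheory Finset
open scoped ENNReal
open Literature.MathematicalPhysics.QuantumFieldTheory.Balaban1983to89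
open Summit.QuantumFields.BalabanUV.T4Continuum.NE1p
open Summit.QuantumFields.BalabanUV.T4Continuum.NE1p.DressedMGFForm (tiltedMean)
open Summit.QuantumFields.BalabanUV.T4Continuum.NE1p.TiltedMeanInfluence (tiltedMean_prod_add influence_eq variance_tilted_le_sq
  tiltedMean_zero_of_centred)
open YMDAG.N14.VarianceSocket (abs_tiltedMean_sub_sub_le)

/-! ## §1 The tilt of a product law by a sum is the product of the tilted marginals -/

section TiltedProduct

variable {Ω S : Type*} [MeasurableSpace Ω] [MeasurableSpace S] (ρ : Measure Ω) (κ : Measure S) [SFinite ρ] [SFinite κ]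

/-- **THE TILTED PRODUCT LAW IS A PRODUCT** [folklore].  For s-finite `ρ`, `κ` and measurable `f : Ω → ℝ`, `g : S → ℝ`:
`(ρ ⊗ κ).tilted (fun p => f p.1 + g p.2) = (ρ.tilted f) ⊗ (κ.tilted g)` — the density `e^{f ⊕ g}∕∫e^{f ⊕ g}` factorises
(`integral_prod_mul`) and products of `withDensity` measures are `withDensity` of the product density (Mathlib `prod_withDensity`).  No
integrability hypothesis: if `e^f` or `e^g` fails to be integrable both sides are `0` by Mathlib's conventions. -/
theorem tilted_prod_add {f : Ω → ℝ} {g : S → ℝ} (hf : Measurable f) (hg : Measurable g) :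
    (ρ.prod κ).tilted (fun p => f p.1 + g p.2) = (ρ.tilted f).prod (κ.tilted g) := by
  simp only [Measure.tilted]
  rw [prod_withDensity (by fun_prop) (by fun_prop)]
  have hZ : ∫ q, Real.exp (f q.1 + g q.2) ∂(ρ.prod κ) = (∫ ω, Real.exp (f ω) ∂ρ) * ∫ x, Real.exp (g x) ∂κ := by
    simp_rw [Real.exp_add]
    exact integral_prod_mul (μ := ρ) (ν := κ) (fun ω => Real.exp (f ω)) (fun x => Real.exp (g x))
  congr 1
  funext p
  rw [hZ, Real.exp_add, ← ENNReal.ofReal_mul (div_nonneg (Real.exp_pos _).le (integral_nonneg fun _ => (Real.exp_pos _).le)),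
    mul_div_mul_comm]

/-- The source tilt of a product law by `s·(G ⊕ h)` is the product of the `s·G`- and `s·h`-tilted marginals. [folklore] -/
theorem tilted_prod_add_mul {G : Ω → ℝ} {h : S → ℝ} (hGm : Measurable G) (hhm : Measurable h) (s : ℝ) :
    (ρ.prod κ).tilted (fun p => s * (G p.1 + h p.2)) = (ρ.tilted fun ω => s * G ω).prod (κ.tilted fun x => s * h x) := by
  have e : (fun p : Ω × S => s * (G p.1 + h p.2)) = fun p => s * G p.1 + s * h p.2 := by funext p; ring
  rw [e]
  exact tilted_prod_add ρ κ (f := fun ω => s * G ω) (g := fun x => s * h x) (by fun_prop) (by fun_prop)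

end TiltedProduct

/-! ## §2 Under a product law the tilted variance of a sum splits -/

section Decoupling

variable {Ω S : Type*} {mΩ : MeasurableSpace Ω} {mS : MeasurableSpace S} {ρ : Measure Ω} {κ : Measure S}
  [IsFiniteMeasure ρ] [IsFiniteMeasure κ] {G : Ω → ℝ} {h : S → ℝ} {B a : ℝ}

/-- A bounded measurable function is in `L²` of any finite measure. [folklore] -/
theorem memLp_two_of_abs_le {X : Type*} {mX : MeasurableSpace X} {μ : Measure X} [IsFiniteMeasure μ] {u : X → ℝ} {c : ℝ}
    (hum : Measurable u) (hu : ∀ x, |u x| ≤ c) : MemLp u 2 μ :=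
  (memLp_top_of_bound hum.aestronglyMeasurable c (ae_of_all _ fun x => by rw [Real.norm_eq_abs]; exact hu x)).mono_exponent
    le_top

/-- **THE TILTED VARIANCE SPLITS UNDER A PRODUCT LAW** [folklore].  `ρ`, `κ` finite and nonzero, `G`, `h` bounded measurable: for every
tilt `s`,
`Var[G ⊕ h; (ρ ⊗ κ).tilted (s·(G ⊕ h))] = Var[G; ρ.tilted (s·G)] + Var[h; κ.tilted (s·h)]` — §1 plus independence of the coordinates
under a product law (Mathlib `variance_add_prod`).  The variance twin of `TiltedMeanInfluence.tiltedMean_prod_add`. -/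
theorem variance_tilted_prod_add [NeZero ρ] [NeZero κ] (hGm : Measurable G) (hG : ∀ ω, |G ω| ≤ B) (hhm : Measurable h)
    (hh : ∀ x, |h x| ≤ a) (s : ℝ) :
    Var[fun p : Ω × S => G p.1 + h p.2; (ρ.prod κ).tilted fun p => s * (G p.1 + h p.2)]
      = Var[G; ρ.tilted fun ω => s * G ω] + Var[h; κ.tilted fun x => s * h x] := by
  haveI : IsProbabilityMeasure (ρ.tilted fun ω => s * G ω) :=
    isProbabilityMeasure_tilted (T4GenFunBounds.integrable_exp_mul_of_bound hGm.aemeasurable (ae_of_all _ hG) s)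
  haveI : IsProbabilityMeasure (κ.tilted fun x => s * h x) :=
    isProbabilityMeasure_tilted (T4GenFunBounds.integrable_exp_mul_of_bound hhm.aemeasurable (ae_of_all _ hh) s)
  rw [tilted_prod_add_mul ρ κ hGm hhm s]
  exact variance_add_prod (memLp_two_of_abs_le hGm hG) (memLp_two_of_abs_le hhm hh)

end Decoupling

/-! ## §3 The influence of re-sampling one decoupled slot on the tilted variance: second order, no centring -/

section Influence

variable {Ω S : Type*} {mΩ : MeasurableSpace Ω} {mS : MeasurableSpace S} {ρ : Measure Ω} {κA κB : Measure S}
  [IsFiniteMeasure ρ] [IsFiniteMeasure κA] [IsFiniteMeasure κB] [NeZero ρ] [NeZero κA] [NeZero κB] {G : Ω → ℝ} {h : S → ℝ} {B a : ℝ}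

/-- **THE VARIANCE INFLUENCE OF ONE SLOT** [folklore].  Re-sampling a decoupled slot (`κ_A ↦ κ_B`, the rest `ρ` untouched) moves the tilted
variance of `G ⊕ h` by EXACTLY the difference of the slot's own tilted variances; the rest cancels. -/
theorem variance_influence_eq (hGm : Measurable G) (hG : ∀ ω, |G ω| ≤ B) (hhm : Measurable h) (hh : ∀ x, |h x| ≤ a) (s : ℝ) :
    Var[fun p : Ω × S => G p.1 + h p.2; (ρ.prod κB).tilted fun p => s * (G p.1 + h p.2)]
      - Var[fun p : Ω × S => G p.1 + h p.2; (ρ.prod κA).tilted fun p => s * (G p.1 + h p.2)]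
      = Var[h; κB.tilted fun x => s * h x] - Var[h; κA.tilted fun x => s * h x] := by
  rw [variance_tilted_prod_add hGm hG hhm hh, variance_tilted_prod_add hGm hG hhm hh]
  ring

/-- **SECOND ORDER WITH NO CENTRING** (LENS control, card 3 on gen 4's model) [folklore].  For ANY two finite slot laws `κ_A`, `κ_B` and
every tilt `s` (all laws finite and nonzero), the influence of re-sampling the slot on the tilted VARIANCE of `G ⊕ h` is at most `a²`
(`|h| ≤ a`): both slot variances lie
in `[0, a²]` (`TiltedMeanInfluence.variance_tilted_le_sq`).  Compare gen 4's first-moment influence: `≤ 2a` in general, second order only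
under centring (`TiltedMeanInfluence.abs_influence_le_of_centred`). -/
theorem abs_variance_influence_le (hGm : Measurable G) (hG : ∀ ω, |G ω| ≤ B) (hhm : Measurable h) (hh : ∀ x, |h x| ≤ a) (s : ℝ) :
    |Var[fun p : Ω × S => G p.1 + h p.2; (ρ.prod κB).tilted fun p => s * (G p.1 + h p.2)]
      - Var[fun p : Ω × S => G p.1 + h p.2; (ρ.prod κA).tilted fun p => s * (G p.1 + h p.2)]| ≤ a ^ 2 := by
  rw [variance_influence_eq hGm hG hhm hh s]
  have hA := variance_tilted_le_sq (ν := κA) hhm hh s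
  have hB := variance_tilted_le_sq (ν := κB) hhm hh s
  have hA0 := variance_nonneg h (κA.tilted fun x => s * h x)
  have hB0 := variance_nonneg h (κB.tilted fun x => s * h x)
  rw [abs_sub_le_iff]
  constructor <;> linarith

/-! ## §4 Back to the tilted mean through the socket: `|Δ(s) − Δ(0)| ≤ a²|s|` unconditionally; centring recovers gen 4 with `a²` -/

/-- **THE MEAN INFLUENCE MOVES AT SECOND ORDER IN THE TILT, UNCONDITIONALLY** [folklore].  With
`Δ(s) := tiltedMean (G ⊕ h) (ρ ⊗ κ_B) s − tiltedMean (G ⊕ h) (ρ ⊗ κ_A) s` the influence of the slot on the tilted mean: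
`|Δ(s) − Δ(0)| ≤ a²·|s|` for every `s` and ANY two finite slot laws — the socket's mean value step
(`…N14VarianceSocket.abs_tiltedMean_sub_sub_le`) fed with §3.  The only first-order datum left is the zero-tilt discrepancy `Δ(0)`. -/
theorem abs_influence_sub_influence_zero_le (hGm : Measurable G) (hG : ∀ ω, |G ω| ≤ B) (hhm : Measurable h) (hh : ∀ x, |h x| ≤ a)
    (s : ℝ) :
    |(tiltedMean (fun p : Ω × S => G p.1 + h p.2) (ρ.prod κB) s - tiltedMean (fun p : Ω × S => G p.1 + h p.2) (ρ.prod κA) s)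
      - (tiltedMean (fun p : Ω × S => G p.1 + h p.2) (ρ.prod κB) 0
          - tiltedMean (fun p : Ω × S => G p.1 + h p.2) (ρ.prod κA) 0)| ≤ a ^ 2 * |s| := by
  have hFm : Measurable fun p : Ω × S => G p.1 + h p.2 := by fun_prop
  have hF : ∀ p : Ω × S, |G p.1 + h p.2| ≤ |B| + |a| := fun p =>
    (abs_add_le _ _).trans (add_le_add ((hG p.1).trans (le_abs_self B)) ((hh p.2).trans (le_abs_self a)))
  exact abs_tiltedMean_sub_sub_le (ν₁ := ρ.prod κA) (ν₂ := ρ.prod κB) (l₀ := |s|) hFm hF hFm hF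
    (fun x _ => abs_variance_influence_le hGm hG hhm hh x) le_rfl

/-- **CENTRING RECOVERS GEN 4 WITH THE BETTER CONSTANT** [folklore].  If both slot laws centre the
slot's contribution (`∫h dκ_A = ∫h dκ_B = 0`) then `Δ(0) = 0` (`TiltedMeanInfluence.influence_eq`, `tiltedMean_zero_of_centred`) and §4
gives `|Δ(s)| ≤ a²·|s|` — `TiltedMeanInfluence.abs_influence_le_of_centred`'s `2a²·|s|` halved. -/
theorem abs_influence_le_of_centred' (hGm : Measurable G) (hG : ∀ ω, |G ω| ≤ B)
    (hhm : Measurable h) (hh : ∀ x, |h x| ≤ a) (h0A : ∫ x, h x ∂κA = 0) (h0B : ∫ x, h x ∂κB = 0) (s : ℝ) :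
    |tiltedMean (fun p : Ω × S => G p.1 + h p.2) (ρ.prod κB) s
      - tiltedMean (fun p : Ω × S => G p.1 + h p.2) (ρ.prod κA) s| ≤ a ^ 2 * |s| := by
  have key := abs_influence_sub_influence_zero_le (ρ := ρ) (κA := κA) (κB := κB) hGm hG hhm hh s
  have h0 : tiltedMean (fun p : Ω × S => G p.1 + h p.2) (ρ.prod κB) 0
      - tiltedMean (fun p : Ω × S => G p.1 + h p.2) (ρ.prod κA) 0 = 0 := by
    rw [influence_eq hGm hG hhm hh, tiltedMean_zero_of_centred h0A, tiltedMean_zero_of_centred h0B, sub_zero]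
  rwa [h0, sub_zero] at key

end Influence

end YMDAG.N14.VarianceInfluence

end
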